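import Summits.QuantumFields.YangMills.Theorems.FluctuationComparisonRegPrIntLS2BetaRelativeFieldSquareSum
import Summits.QuantumFields.YangMills.Theorems.FluctuationComparisonRegPrIntLS2BetaArcBondSplit
import HarnessLib

/-!
# S2β · `hFlat` road, brick (ii-b)₆ of UV3-NODE §57.8 (D) — THE ℓ² RELATIVE LETTER READ ON THE TREE's PLAQUETTES `Plaq P j`

Cell `ym3-torus` (rung R3 = continuum `SU(2)` Yang–Mills on the three-torus — NOT d = 4, NOT infinite volume, NOT a mass gap, NOT Clay).
Width seat «width 13» `ym3-torus-px13` (gen 22), FREE px helper on crux `stmt-QuantumFields-20520`, count-neutral, DEFINITION-FREE, any gauge group.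

WHY.  ✓(ii-b)₅ `…RelativeFieldSquareSum.sq_sum_le` bounds `R² = Σ_b dist1(W_b·U₀,b⁻¹)²` by sums over plaquette POSITIONS `q = (site; μ, κ)`, `μ ≠ κ` (both axis
orders, the natural index of the slot families).  The assembler's flux norms `‖f^{(t)}‖²` are sums over the tree's plaquette type `Plaq P j` (`μ < ν`,
`GaugeField.plaqHol`, as in `wilsonAction`).  This adapter identifies the two (`rect U x μ ν 1 1 = U(∂p)` for `μ < ν`, lit ✓`B10Eq47AxialChi.rect_one_one`; the
swapped order is the inverse holonomy, same `dist1`, ✓`rect_swap`) and restates the ℓ² letter on `Plaq P j`.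
* `sum_positions_sq_eq_two_mul_sum_plaq` — `Σ_{q, μ≠κ} dist1 U(∂q)² = 2·Σ_{p : Plaq P j} dist1 U(∂p)²`;
* ★★★ `sq_sum_le_plaq` — `Σ_b dist1(W_b·U₀,b⁻¹)² ≤ 2·C₁(d,L)·(Σ_p dist1 W(∂p)² + Σ_p dist1 U₀(∂p)²) + 2L^{d−1}·Σ_c dist1 (U_W(c)·U₀(c)⁻¹)²`;
* ★★★ `sqrt_sum_arc_sq_le` — the ONE-LEVEL STEP OF (B) IN ARC CURRENCY for `SU(2)`: `‖arc W‖₂ ≤ ‖arc U₀‖₂ + (π∕2)·√(2C₁·(‖f_W‖² + ‖f_0‖²) + 2L^{d−1}·‖spine quotients‖²)`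
  (✓(ii-b)₃ `sqrt_sum_sq_norm_logVec_le` ∘ `sq_sum_le_plaq`); with `U₀` the hat lift and ✓(ii-a) `‖arc U₀‖₂ ≤ √L·‖arc X‖₂` this is `B_t ≤ √L·B_{t+1} + R_t`.

HONEST SCOPE.  Reindexing only; nothing of Bałaban's; `hFlat`, TUBE-REG∘, GAP♯∘, S2β, crux 20520, `YM3TorusSU2` NOT proved; no registered stub closed; the
Yang–Mills mass gap is NOT proved.
References: T. Bałaban, CMP **98** (1985) 17–51 [Balaban1985Averaging] ((9) p.19); CMP **99** (1985) 75–102 [Balaban1985RegularSpaces] ((1.29) p.81).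
-/

set_option autoImplicit false

namespace Summit.QuantumFields.YangMills.Theorems.FluctuationComparisonRegPrIntLS2BetaRelativeFieldSquareSumPlaq

open Finset
open Literature.MathematicalPhysics.QuantumFieldTheory.Balaban1983to89
open T4Continuum
open B10Eq47AxialChi (rect rect_one_one)
open B10Eq27TorusAxialLog (axialT)
open Summit.QuantumFields.YangMills.Theorems.FluctuationComparisonRegPrIntLS2BetaRowTransportVariance (rect_swap)
open Summit.QuantumFields.YangMills.Theorems.FluctuationComparisonRegPrIntLS2BetaRelativeFieldSquareSum (sq_sum_le)

variable {P : Params} {j : ℕ} {G : Type*} [GaugeGroup G]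

/-- The `dist1` of a unit square does not see the order of its axes (`U(∂R_{μν}) = U(∂R_{νμ})⁻¹`). [cite: Balaban1985Averaging, (9) p.19, (20) p.21] -/
theorem dist1_rect_one_one_comm (U : GaugeField P j G) (x : Site P j) (μ ν : Fin P.d) :
    dist1 (rect U x μ ν 1 1) = dist1 (rect U x ν μ 1 1) := by
  rw [rect_swap U x μ ν 1 1, GaugeGroup.dist1_inv]

/-- **Positions versus plaquettes**: the sum of `dist1 U(∂q)²` over plaquette positions `(x; μ ≠ κ)` is twice the sum over the tree's plaquettes `Plaq P j`
(`μ < ν`). [cite: Balaban1985Averaging, (9) p.19] -/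
theorem sum_positions_sq_eq_two_mul_sum_plaq (U : GaugeField P j G) :
    ∑ q ∈ (univ : Finset (Site P j × Fin P.d × Fin P.d)).filter (fun q => q.2.1 ≠ q.2.2), dist1 (rect U q.1 q.2.1 q.2.2 1 1) ^ 2 =
      2 * ∑ p : Plaq P j, dist1 (GaugeField.plaqHol U p) ^ 2 := by
  classical
  set g : Site P j × Fin P.d × Fin P.d → ℝ := fun q => dist1 (rect U q.1 q.2.1 q.2.2 1 1) ^ 2 with hg
  -- the plaquette sum is the sum over the positions with `μ < κ`
  have hlt : ∑ q ∈ (univ : Finset (Site P j × Fin P.d × Fin P.d)).filter (fun q => q.2.1 < q.2.2), g q =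
      ∑ p : Plaq P j, dist1 (GaugeField.plaqHol U p) ^ 2 := by
    rw [sum_subtype ((univ : Finset (Site P j × Fin P.d × Fin P.d)).filter (fun q => q.2.1 < q.2.2))
      (p := fun q : Site P j × Fin P.d × Fin P.d => q.2.1 < q.2.2) (fun q => by simp)]
    refine Fintype.sum_equiv ⟨fun t => ⟨t.1.1, t.1.2.1, t.1.2.2, t.2⟩, fun p => ⟨(p.src, p.μ, p.ν), p.hμν⟩, fun _ => rfl, fun _ => rfl⟩ _ _
      fun t => ?_
    show dist1 (rect U t.1.1 t.1.2.1 t.1.2.2 1 1) ^ 2 = dist1 (GaugeField.plaqHol U ⟨t.1.1, t.1.2.1, t.1.2.2, t.2⟩) ^ 2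
    rw [rect_one_one U t.1.1 t.2]
  -- the positions with `μ > κ` contribute the same, by swapping the axes
  have hgt : ∑ q ∈ (univ : Finset (Site P j × Fin P.d × Fin P.d)).filter (fun q => q.2.2 < q.2.1), g q =
      ∑ q ∈ (univ : Finset (Site P j × Fin P.d × Fin P.d)).filter (fun q => q.2.1 < q.2.2), g q := by
    refine sum_nbij' (fun q => (q.1, q.2.2, q.2.1)) (fun q => (q.1, q.2.2, q.2.1)) (fun q hq => ?_) (fun q hq => ?_)
      (fun q _ => rfl) (fun q _ => rfl) (fun q _ => ?_)
    · simp only [mem_filter, mem_univ, true_and] at hq ⊢; exact hq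
    · simp only [mem_filter, mem_univ, true_and] at hq ⊢; exact hq
    · simp only [hg]; rw [dist1_rect_one_one_comm]
  -- split `≠` into `<` and `>`
  have hsplit : (univ : Finset (Site P j × Fin P.d × Fin P.d)).filter (fun q => q.2.1 ≠ q.2.2) =
      (univ : Finset (Site P j × Fin P.d × Fin P.d)).filter (fun q => q.2.1 < q.2.2) ∪
        (univ : Finset (Site P j × Fin P.d × Fin P.d)).filter (fun q => q.2.2 < q.2.1) := by
    ext q
    simp only [mem_filter, mem_univ, true_and, mem_union]
    exact ⟨fun h => lt_or_gt_of_ne h, fun h => h.elim ne_of_lt ne_of_gt⟩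
  have hdisj : Disjoint ((univ : Finset (Site P j × Fin P.d × Fin P.d)).filter (fun q => q.2.1 < q.2.2))
      ((univ : Finset (Site P j × Fin P.d × Fin P.d)).filter (fun q => q.2.2 < q.2.1)) := by
    rw [disjoint_filter]
    intro q _ h1 h2
    exact lt_asymm h1 h2
  rw [hsplit, sum_union hdisj, hgt, hlt]
  ring

/-- ★★★ **THE ℓ² RELATIVE LETTER AT ONE LEVEL, ON THE TREE's PLAQUETTES**: ✓(ii-b)₅ `sq_sum_le` with the flux norms over `Plaq P j`.
[cite: Balaban1985RegularSpaces, Lemma 1 (1.25)-(1.26) p.79, (1.29) p.81; Balaban1987RG1, (0.3)-(0.4) pp.252-253] -/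
theorem sq_sum_le_plaq (hj : j + 1 ≤ P.m + P.K) (W U₀ : GaugeField P j G)
    (hax : ∀ x : Site P j, axialT W (emb (blockOf x)) x = axialT U₀ (emb (blockOf x)) x) :
    ∑ b : PBond P j, dist1 (W b * (U₀ b)⁻¹) ^ 2 ≤
      2 * (2 * ((P.d - 1) * ((P.L - 1) / 2) : ℕ) * (2 * P.L ^ P.d * ((P.d - 1) * ((P.L - 1) / 2)) : ℕ) +
          4 * ((P.d - 1) * ((P.L - 1) / 2) * (P.L + 1) : ℕ) * (2 * P.L ^ P.d * ((P.d - 1) * ((P.L - 1) / 2) * (P.L + 1)) : ℕ)) *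
          (∑ p : Plaq P j, dist1 (GaugeField.plaqHol W p) ^ 2 + ∑ p : Plaq P j, dist1 (GaugeField.plaqHol U₀ p) ^ 2) +
        2 * P.L ^ (P.d - 1) * ∑ c : PBond P (j + 1), dist1 (AveragingRT.axialAvg W c * (AveragingRT.axialAvg U₀ c)⁻¹) ^ 2 := by
  have h := sq_sum_le hj W U₀ hax
  rw [sum_positions_sq_eq_two_mul_sum_plaq, sum_positions_sq_eq_two_mul_sum_plaq] at h
  linarith

/-- ★★★ **THE ONE-LEVEL STEP OF THE RECURSION (B) IN ARC CURRENCY, `SU(2)`**: for `W` comb-axial relative to `U₀` from every block centre,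
`√(Σ_b arc(W_b)²) ≤ √(Σ_b arc(U₀,b)²) + (π∕2)·√(2C₁(d,L)·(Σ_p dist1 W(∂p)² + Σ_p dist1 U₀(∂p)²) + 2L^{d−1}·Σ_c dist1 (U_W(c)·U₀(c)⁻¹)²)` — ✓(ii-b)₃'s bond split
and finite Minkowski composed with `sq_sum_le_plaq`.  With `U₀ :=` the geodesic hat lift of the coarser field (px12 g23 (ii-a⁺)) and ✓(ii-a) p813925
(`‖arc U₀‖₂ ≤ √L·‖arc X‖₂` exactly) this is UV3-NODE §57.8 (B)'s `B_t ≤ √L·B_{t+1} + R_t` with `R_t` in one-level flux ∕ correction norms.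
[cite: Balaban1985RegularSpaces, (1.29) p.81] -/
theorem sqrt_sum_arc_sq_le (hj : j + 1 ≤ P.m + P.K) (W U₀ : GaugeField P j T4CubeChartGnomonic.SU2)
    (hax : ∀ x : Site P j, axialT W (emb (blockOf x)) x = axialT U₀ (emb (blockOf x)) x) :
    √(∑ b : PBond P j, ‖T4ExpWindowSmallField.logVec (Literature.MathematicalPhysics.QuantumLattice.su2Quat (W b))‖ ^ 2) ≤
      √(∑ b : PBond P j, ‖T4ExpWindowSmallField.logVec (Literature.MathematicalPhysics.QuantumLattice.su2Quat (U₀ b))‖ ^ 2) +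
        Real.pi / 2 * √(2 * (2 * ((P.d - 1) * ((P.L - 1) / 2) : ℕ) * (2 * P.L ^ P.d * ((P.d - 1) * ((P.L - 1) / 2)) : ℕ) +
            4 * ((P.d - 1) * ((P.L - 1) / 2) * (P.L + 1) : ℕ) * (2 * P.L ^ P.d * ((P.d - 1) * ((P.L - 1) / 2) * (P.L + 1)) : ℕ)) *
            (∑ p : Plaq P j, dist1 (GaugeField.plaqHol W p) ^ 2 + ∑ p : Plaq P j, dist1 (GaugeField.plaqHol U₀ p) ^ 2) +
          2 * P.L ^ (P.d - 1) * ∑ c : PBond P (j + 1), dist1 (AveragingRT.axialAvg W c * (AveragingRT.axialAvg U₀ c)⁻¹) ^ 2) := by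
  have h1 := FluctuationComparisonRegPrIntLS2BetaArcBondSplit.sqrt_sum_sq_norm_logVec_le (univ : Finset (PBond P j)) (fun b => W b) fun b => U₀ b
  have h2 := Real.sqrt_le_sqrt (sq_sum_le_plaq hj W U₀ hax)
  have hπ : 0 ≤ Real.pi / 2 := by positivity
  exact h1.trans (add_le_add le_rfl (mul_le_mul_of_nonneg_left h2 hπ))

end Summit.QuantumFields.YangMills.Theorems.FluctuationComparisonRegPrIntLS2BetaRelativeFieldSquareSumPlaq
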